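import Summits.Ventures.PercRepro.RankLevelSetRuleQSliceBorderAll
import Summits.Ventures.PercRepro.RankLevelSetRuleQSliceMapsModel
import Summits.Ventures.PercRepro.RankLevelSetRuleQSliceNegAll

/-!
# PercRepro — THE MAP OF RULE Q ON THE TRUNCATED SLICES `u ≤ k − 2` OF EVERY FAMILY `k ≥ 5` (night-1, gen 21; dossier §32)

With the borderline theorem (`rhat_borderline_all`, `ruleQRecv_ge_phiK_borderline_all`), the end slices `u ≤ 1` (`rhatCell_self`,
`rhatCell_pred`, `ruleQRecv_ge_phiK_of_top`) and the negative half (`rhat_slice_only_if`, `ruleQ_slice_only_if`, gen 20), the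
map of Rule Q's equal split on the truncated slices is decided for EVERY family:
* **`rhat_slice_iff_of_le_border (k u) (5 ≤ k) (u ≤ k − 2) : (∀ q ≥ u, Φ(q+k, q) ≤ R̂(q, k, q − u)) ↔ (u ≤ 1 ∨ u = k − 2)`**;
* **`ruleQ_slice_iff_of_le_border`** — the same at the matroid level: the slice `u ≤ k − 2` of the family `k ≥ 5` is paid at
  every member of every cell `(q+k, q)` of every finite matroid (tight layer) iff `u ≤ 1` or `u = k − 2`;
* `rhat_slice_of_le_one_or_border`, `ruleQRecv_ge_phiK_of_le_one_or_border` — the positive halves spelled out.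
The untruncated slices `u ≥ k − 1` (paid wherever the whole-cell theorems apply: every `q` for `k ≤ 9` by
`rhat_slice_iff_le_nine`) are the remaining half of the map. Axioms: standard.
-/

namespace PercRepro

open Finset

/-- **The positive half on the truncated slices**: `u ≤ 1` or `u = k − 2` ⇒ `Φ(q+k, q) ≤ R̂(q, k, q − u)` for every `q ≥ u`
(`k ≥ 5`). -/
theorem rhat_slice_of_le_one_or_border (k u : ℕ) (hk : 5 ≤ k) (h : u ≤ 1 ∨ u = k - 2) (q : ℕ) (hq : u ≤ q) :
    phiK (q + k) q ≤ rhat q k (q - u) := by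
  rcases h with h | rfl
  · interval_cases u
    · rw [Nat.sub_zero]; exact rhatCell_self q k (by omega)
    · exact rhatCell_pred q k (by omega) (by omega)
  · exact rhat_borderline_all k q hk hq

/-- **THE MAP ON THE TRUNCATED SLICES `u ≤ k − 2`, EVERY FAMILY `k ≥ 5`**: the slice `u` is paid on every cell `(q+k, q)`
iff `u ≤ 1` or `u = k − 2` (the `k − 4` slices `2 ≤ u ≤ k − 3` fail from `q = 4^{k+3} + u` on). -/
theorem rhat_slice_iff_of_le_border (k u : ℕ) (hk : 5 ≤ k) (hu : u ≤ k - 2) :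
    (∀ q, u ≤ q → phiK (q + k) q ≤ rhat q k (q - u)) ↔ (u ≤ 1 ∨ u = k - 2) := by
  constructor
  · intro h
    have := rhat_slice_only_if k u hk h
    omega
  · intro h q hq
    exact rhat_slice_of_le_one_or_border k u hk h q hq

/-- **The positive half at the matroid level**: `u ≤ 1` or `u = k − 2` ⇒ every member `Z` of the cell `(q+k, q)` with
`#(flatPart M Z) = q − u` is paid (`k ≥ 5`, tight layer). -/
theorem ruleQRecv_ge_phiK_of_le_one_or_border {β : Type} (M : Matroid β) [M.Finite] {q k u : ℕ} (hk : 5 ≤ k)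
    (h : u ≤ 1 ∨ u = k - 2) (hq : u ≤ q) (hE : M.E.ncard = (q + k) + q) {Z : Set β} (hZ : Z ∈ cellMembers M (q + k) q)
    (hP : (flatPart M Z).ncard = q - u) :
    phiK (q + k) q ≤ ruleQRecv M (q + k) q Z := by
  rcases h with h1 | rfl
  · exact ruleQRecv_ge_phiK_of_top M (by omega) hE hZ (by omega)
  · exact ruleQRecv_ge_phiK_borderline_all M hk hq hE hZ hP

/-- **THE MAP ON THE TRUNCATED SLICES AT THE MATROID LEVEL, EVERY FAMILY `k ≥ 5`**: the slice `u ≤ k − 2` is paid at every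
member of every cell `(q+k, q)` (`q ≥ u`) of every finite matroid at the tight layer iff `u ≤ 1` or `u = k − 2`. -/
theorem ruleQ_slice_iff_of_le_border (k u : ℕ) (hk : 5 ≤ k) (hu : u ≤ k - 2) :
    (∀ (β : Type) (M : Matroid β) (hf : M.Finite) (q : ℕ), u ≤ q → M.E.ncard = (q + k) + q →
        ∀ Z ∈ cellMembers M (q + k) q, (flatPart M Z).ncard = q - u →
          phiK (q + k) q ≤ @ruleQRecv β M hf (q + k) q Z) ↔ (u ≤ 1 ∨ u = k - 2) := by
  constructor
  · intro h
    have := ruleQ_slice_only_if k u hk h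
    omega
  · intro h β M hf q hq hE Z hZ hP
    exact @ruleQRecv_ge_phiK_of_le_one_or_border β M hf q k u hk h hq hE Z hZ hP

end PercRepro
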